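import Summits.QuantumFields.YangMills.Theorems.F4SubCurvatureDoorSubCurvatureKernelExtraction
import Summits.QuantumFields.YangMills.Theorems.F4SubCurvatureDoorSubCurvatureKernelExplicitDensity
import Summits.QuantumFields.YangMills.Theorems.F4SubCurvatureDoorSubCurvatureKernelTranslationRung
import HarnessLib

/-!
# Route `F4SubCurvatureDoor`, crux `SubCurvatureKernel` ⟨stmt-QuantumFields-23036⟩ — ONE kernel for ALL separations: gluing the `δ`-kernels,
# with the `‖u‖⁻⁸` bound at the diagonal

Helper file (`--supports stmt-QuantumFields-23036 --as helper`; free-hands seat `ym-line-frs-p2` g17, clause (K) of the soft-half scope, HOME INBOX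
2026-08-29T16:34:27Z / 16:47:40Z).  Definition-free, 0 sorry, standard axioms.  No item is closed; no summit, no crux and no mass gap is proved by
this file.

WHAT.  ✓`exists_kernel_of_translate_invariant` gives, for EACH separation `δ`, a bounded kernel representing the two-point functional on test functions
supported in `Separated 2 δ`.  Here the dyadic family `δ_j = 2^{-j}` is GLUED into a single measurable kernel `K : ℝ⁴ → ℂ` (on the shell
`2^{-j} < ‖u‖ ≤ 2^{1-j}` take the `j`-th kernel; different kernels agree a.e. where both apply — uniqueness of difference kernels, via the fundamental
lemma on the open set `{δ < ‖x₀ − x₁‖}` and the fact that `x ↦ x₀ − x₁` pulls null sets back to null sets and only null sets):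

* `volume_preimage_sub_eq_zero_iff` — `{x : (ℝ⁴)² | x₀ − x₁ ∈ N}` is Lebesgue-null iff `N` is;
* `ae_eq_of_repr_eq` — two bounded measurable difference kernels representing the same functional on smooth compactly supported test functions
  supported in `{δ < ‖x₀ − x₁‖}` agree a.e. on `{δ < ‖u‖}`;
* ★ `exists_gluedKernel_of_offDiagLimitAlong` — for every off-diagonal limit point of an admissible leg scheme (under `MomentBounds6`): ONE measurable
  `K : ℝ⁴ → ℂ` with the POLYNOMIAL bound `‖K u‖ ≤ A (1 + ‖u‖⁻¹)⁸` (from the explicit density constant ✓`norm_le_explicit_of_offDiagLimitAlong`,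
  `B(δ) ≍ δ⁻⁸`) such that `S₁ 2 F = ∫ K(x₀ − x₁) F(x) dx` for EVERY `δ > 0` and every compactly supported test function supported in `Separated 2 δ`.

HONEST LABEL: clause (K) of the SOFT half of ⟨23036⟩ off the diagonal with one kernel; the verbatim clause 6 (test functions whose support TOUCHES the
diagonal, vanishing there to infinite order) needs in addition the flat-vanishing bound `|F(x)| ≲ ‖x₀ − x₁‖⁸` against the `‖u‖⁻⁸` kernel bound — not in
this file; (C) continuity and the SUB-CURVATURE clause remain OPEN; ⟨23036⟩ is an open problem; the Yang–Mills mass gap is NOT proved; no summit is proved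
by a line.
-/

set_option autoImplicit false

noncomputable section

open scoped SchwartzMap BigOperators ContDiff ENNReal
open MeasureTheory Filter Topology Set
open Literature.MathematicalPhysics.QuantumFieldTheory Literature.MathematicalPhysics.QuantumLattice
open Literature.MathematicalPhysics.AQFT
open Summit.QuantumFields.YangMills.Cruxes.OSLegsFromFemtoAndGap.DlrCollarTransfer (MomentBounds6)
open Summit.QuantumFields.YangMills.Cruxes.OSLegsAtWeakCouplingC.Sketch (Separated OffDiagDensity)
open Summit.QuantumFields.YangMills.Theorems.ROT (IsLegScheme OffDiagLimitAlong)
open Summit.QuantumFields.YangMills.Theorems.NPointIsotropy.Negative (E4)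
open Summit.QuantumFields.YangMills.Theorems.F4SubCurvatureDoorSubCurvatureKernelDensity (mem_separated_of_le)
open Summit.QuantumFields.YangMills.Theorems.F4SubCurvatureDoorSubCurvatureKernelExtraction
  (exists_kernel_of_translate_invariant test_props)
open Summit.QuantumFields.YangMills.Theorems.F4SubCurvatureDoorSubCurvatureKernelExplicitDensity (norm_le_explicit_of_offDiagLimitAlong)
open Summit.QuantumFields.YangMills.Theorems.F4SubCurvatureDoorSubCurvatureKernelTranslation (translate_invariant_of_offDiagLimitAlong)

namespace Summit.QuantumFields.YangMills.Theorems.F4SubCurvatureDoorSubCurvatureKernelGlued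

/-! ## Null sets pull back along `x ↦ x₀ − x₁` to null sets, and only null sets -/

/-- `vol {x : (ℝ⁴)² | x₀ − x₁ ∈ N} = vol N · ∞`. [folklore] -/
theorem volume_preimage_sub (N : Set E4) (hN : MeasurableSet N) :
    volume {x : Fin 2 → E4 | x 0 - x 1 ∈ N} = volume N * (⊤ : ℝ≥0∞) := by
  have hsub : Measurable fun p : E4 × E4 => p.1 - p.2 := measurable_fst.sub measurable_snd
  have hT : MeasurableSet {p : E4 × E4 | p.1 - p.2 ∈ N} := hN.preimage hsub
  have hpre : {x : Fin 2 → E4 | x 0 - x 1 ∈ N} = MeasurableEquiv.finTwoArrow ⁻¹' {p : E4 × E4 | p.1 - p.2 ∈ N} := by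
    ext x; simp [MeasurableEquiv.finTwoArrow_apply]
  rw [hpre, (volume_preserving_finTwoArrow E4).measure_preimage hT.nullMeasurableSet,
    show (volume : Measure (E4 × E4)) = volume.prod volume from rfl, Measure.prod_apply hT]
  have hsec : ∀ a : E4, volume (Prod.mk a ⁻¹' {p : E4 × E4 | p.1 - p.2 ∈ N}) = volume N := fun a => by
    have h : Prod.mk a ⁻¹' {p : E4 × E4 | p.1 - p.2 ∈ N} = (fun b : E4 => a - b) ⁻¹' N := by
      ext b; simp
    rw [h]
    exact (Measure.measurePreserving_sub_left volume a).measure_preimage hN.nullMeasurableSet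
  simp_rw [hsec]
  rw [lintegral_const, measure_univ_of_isAddLeftInvariant]

/-- `{x | x₀ − x₁ ∈ N}` is null iff `N` is. [folklore] -/
theorem volume_preimage_sub_eq_zero_iff (N : Set E4) (hN : MeasurableSet N) :
    volume {x : Fin 2 → E4 | x 0 - x 1 ∈ N} = 0 ↔ volume N = 0 := by
  rw [volume_preimage_sub N hN, mul_eq_zero]
  simp

/-! ## Uniqueness of difference kernels on `{δ < ‖u‖}` -/

/-- **Uniqueness of difference kernels.**  Two bounded measurable kernels whose difference-variable pull-backs have the same integrals against all
smooth compactly supported real test functions supported in `{δ < ‖x₀ − x₁‖}` agree a.e. on `{δ < ‖u‖}`. [folklore] -/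
theorem ae_eq_of_repr_eq (K K' : E4 → ℂ) (hK : Measurable K) (hK' : Measurable K') {B : ℝ} (hKb : ∀ u, ‖K u‖ ≤ B)
    (hK'b : ∀ u, ‖K' u‖ ≤ B) (δ : ℝ)
    (h : ∀ g : (Fin 2 → E4) → ℝ, ContDiff ℝ ∞ g → HasCompactSupport g → tsupport g ⊆ {x | δ < ‖x 0 - x 1‖} →
      ∫ x, g x • (K (x 0 - x 1) - K' (x 0 - x 1)) = 0) :
    ∀ᵐ u : E4, δ < ‖u‖ → K u = K' u := by
  set U : Set (Fin 2 → E4) := {x | δ < ‖x 0 - x 1‖} with hU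
  have hUo : IsOpen U := isOpen_lt continuous_const ((continuous_apply 0).sub (continuous_apply 1)).norm
  set D : (Fin 2 → E4) → ℂ := fun x => K (x 0 - x 1) - K' (x 0 - x 1) with hD
  have hsubm : Measurable fun x : Fin 2 → E4 => x 0 - x 1 := (measurable_pi_apply 0).sub (measurable_pi_apply 1)
  have hDm : Measurable D := (hK.comp hsubm).sub (hK'.comp hsubm)
  have hDb : ∀ x, ‖D x‖ ≤ ‖((B + B : ℝ) : ℂ)‖ := fun x => by
    rw [Complex.norm_real, Real.norm_eq_abs, abs_of_nonneg (by linarith [norm_nonneg (K 0), hKb 0])]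
    exact (norm_sub_le _ _).trans (add_le_add (hKb _) (hK'b _))
  have hDli : LocallyIntegrableOn D U volume :=
    ((locallyIntegrable_const ((B + B : ℝ) : ℂ)).mono hDm.aestronglyMeasurable (Eventually.of_forall hDb)).locallyIntegrableOn U
  have hae : ∀ᵐ x : Fin 2 → E4, x ∈ U → D x = 0 := hUo.ae_eq_zero_of_integral_contDiff_smul_eq_zero hDli h
  -- pull back
  set N : Set E4 := {u | δ < ‖u‖ ∧ K u ≠ K' u} with hN
  have hNm : MeasurableSet N :=
    (isOpen_lt continuous_const continuous_norm).measurableSet.inter (measurableSet_eq_fun hK hK').compl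
  have hpre : volume {x : Fin 2 → E4 | x 0 - x 1 ∈ N} = 0 := by
    have h0 := ae_iff.1 hae
    have hset : {x : Fin 2 → E4 | x 0 - x 1 ∈ N} = {x | ¬(x ∈ U → D x = 0)} := by
      ext x
      simp only [hN, hU, hD, mem_setOf_eq, Classical.not_imp, sub_ne_zero]
    rw [hset]
    exact h0
  have hNull : volume N = 0 := (volume_preimage_sub_eq_zero_iff N hNm).1 hpre
  rw [ae_iff]
  have hset' : {u : E4 | ¬(δ < ‖u‖ → K u = K' u)} = N := by
    ext u
    simp only [hN, mem_setOf_eq, Classical.not_imp]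
  rw [hset']
  exact hNull

/-- From representations to the hypothesis of `ae_eq_of_repr_eq`: if both kernels represent the same functional on compactly supported Schwartz test
functions supported in `Separated 2 δ` (`δ > 0`), the integrals against real smooth compactly supported `g` supported in `{δ < ‖x₀ − x₁‖}` agree. -/
theorem integral_smul_sub_eq_zero_of_repr (S₂ : 𝓢((Fin 2 → E4), ℂ) →L[ℂ] ℂ) (K K' : E4 → ℂ) {δ : ℝ} (hδ : 0 < δ)
    (hK : ∀ F : 𝓢((Fin 2 → E4), ℂ), HasCompactSupport (F : (Fin 2 → E4) → ℂ) →
      tsupport (F : (Fin 2 → E4) → ℂ) ⊆ Separated 2 δ →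
        Integrable (fun x : Fin 2 → E4 => K (x 0 - x 1) * F x) ∧ S₂ F = ∫ x : Fin 2 → E4, K (x 0 - x 1) * F x)
    (hK' : ∀ F : 𝓢((Fin 2 → E4), ℂ), HasCompactSupport (F : (Fin 2 → E4) → ℂ) →
      tsupport (F : (Fin 2 → E4) → ℂ) ⊆ Separated 2 δ →
        Integrable (fun x : Fin 2 → E4 => K' (x 0 - x 1) * F x) ∧ S₂ F = ∫ x : Fin 2 → E4, K' (x 0 - x 1) * F x) :
    ∀ g : (Fin 2 → E4) → ℝ, ContDiff ℝ ∞ g → HasCompactSupport g → tsupport g ⊆ {x | δ < ‖x 0 - x 1‖} →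
      ∫ x, g x • (K (x 0 - x 1) - K' (x 0 - x 1)) = 0 := by
  intro g hgs hgc hgU
  have hδ2 : 0 < δ / 2 := by positivity
  have hgU' : tsupport g ⊆ {x : Fin 2 → E4 | 2 * (δ / 2) < ‖x 0 - x 1‖} := by
    intro x hx; have h := hgU hx; simp only [mem_setOf_eq] at h ⊢; linarith
  obtain ⟨hc, hs, hsep, -⟩ := test_props hδ2 g hgs hgc hgU'
  set G : 𝓢((Fin 2 → E4), ℂ) := hc.toSchwartzMap hs with hG
  have hGf : ∀ x, G x = ((g x : ℝ) : ℂ) := fun x => rfl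
  have hsep' : tsupport (G : (Fin 2 → E4) → ℂ) ⊆ Separated 2 δ := by
    intro x hx; have h := hsep hx; simpa [two_mul, add_halves] using h
  obtain ⟨hI, h1⟩ := hK G hc hsep'
  obtain ⟨hI', h2⟩ := hK' G hc hsep'
  have hzero : ∫ x : Fin 2 → E4, (K (x 0 - x 1) - K' (x 0 - x 1)) * G x = 0 := by
    have h : ∫ x : Fin 2 → E4, (K (x 0 - x 1) - K' (x 0 - x 1)) * G x =
        (∫ x : Fin 2 → E4, K (x 0 - x 1) * G x) - ∫ x : Fin 2 → E4, K' (x 0 - x 1) * G x := by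
      rw [← integral_sub hI hI']
      refine integral_congr_ae (Eventually.of_forall fun x => ?_)
      ring
    rw [h, ← h1, ← h2, sub_self]
  rw [← hzero]
  refine integral_congr_ae (Eventually.of_forall fun x => ?_)
  beta_reduce
  rw [hGf, Complex.real_smul, mul_comm]

/-! ## ★ One kernel for all separations -/

variable {G : Type} [Group G] [TopologicalSpace G] [IsTopologicalGroup G] [CompactSpace G]
  [MeasurableSpace G] [BorelSpace G]

/-- ★ **THE GLUED KERNEL.**  Under `MomentBounds6 G r a` (positive unit map `a → 0`), along every admissible leg scheme and subsequence, every
off-diagonal limit point `S₁` has ONE measurable two-point kernel `K : ℝ⁴ → ℂ` of the difference variable with the polynomial bound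
`‖K u‖ ≤ A (1 + ‖u‖⁻¹)⁸` representing `S₁ 2` on every compactly supported test function supported in some `Separated 2 δ`, `δ > 0`.
[cite: OS1973, §2] [cite: GlimmJaffe1987, §6.1] [cite: Rudin1987, Thm. 6.16] -/
theorem exists_gluedKernel_of_offDiagLimitAlong (r : LatticeRep G) {a : ℝ → ℝ} (hapos : ∀ β, 0 < a β)
    (ha0 : Tendsto a atTop (𝓝 0)) (hMB : MomentBounds6 G r a) {sch : SpeciesScheme (YMSpecies G)}
    (hsch : IsLegScheme a sch) {φ : ℕ → ℕ} (hφ : Tendsto φ atTop atTop) {S₁ : SchwingerFamily E4}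
    (hS₁ : OffDiagLimitAlong r sch φ S₁) :
    ∃ K : E4 → ℂ, Measurable K ∧ (∃ A : ℝ, ∀ u, ‖K u‖ ≤ A * (1 + ‖u‖⁻¹) ^ 8) ∧
      ∀ δ : ℝ, 0 < δ → ∀ F : 𝓢((Fin 2 → E4), ℂ), HasCompactSupport (F : (Fin 2 → E4) → ℂ) →
        tsupport (F : (Fin 2 → E4) → ℂ) ⊆ Separated 2 δ →
          Integrable (fun x : Fin 2 → E4 => K (x 0 - x 1) * F x) ∧ S₁ 2 F = ∫ x : Fin 2 → E4, K (x 0 - x 1) * F x := by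
  classical
  obtain ⟨C, ℓ₄, hC, hℓ, Hd⟩ := norm_le_explicit_of_offDiagLimitAlong r hMB hsch hφ hS₁
  have htrans : ∀ (t : E4) (F : 𝓢((Fin 2 → E4), ℂ)), IsOffDiagonal F → S₁ 2 (translateMulti t F) = S₁ 2 F :=
    fun t F hF => translate_invariant_of_offDiagLimitAlong r hapos ha0 hMB hsch hφ hS₁ 2 t F hF
  -- the dyadic scales and their density constants
  set dl : ℕ → ℝ := fun j => ((2 : ℝ) ^ j)⁻¹ with hdl
  have hdl_pos : ∀ j, 0 < dl j := fun j => by positivity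
  set Bf : ℕ → ℝ := fun j => (C * (24 / (dl j / 3) + 2 / ℓ₄ + 24) ^ 4) ^ 2 with hBf
  have hBf0 : ∀ j, 0 ≤ Bf j := fun j => by positivity
  have hdens : ∀ j, ∀ F : 𝓢((Fin 2 → E4), ℂ), HasCompactSupport (F : (Fin 2 → E4) → ℂ) →
      tsupport (F : (Fin 2 → E4) → ℂ) ⊆ Separated 2 (dl j / 3) → ‖S₁ 2 F‖ ≤ Bf j * ∫ x, ‖F x‖ :=
    fun j F hFc hFs => Hd 2 le_rfl (dl j / 3) (by positivity) F hFc hFs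
  -- one kernel per scale
  have hKj : ∀ j, ∃ Kj : E4 → ℂ, Measurable Kj ∧ (∀ u, ‖Kj u‖ ≤ 2 * Bf j) ∧
      ∀ F : 𝓢((Fin 2 → E4), ℂ), HasCompactSupport (F : (Fin 2 → E4) → ℂ) →
        tsupport (F : (Fin 2 → E4) → ℂ) ⊆ Separated 2 (dl j) →
          Integrable (fun x : Fin 2 → E4 => Kj (x 0 - x 1) * F x) ∧ S₁ 2 F = ∫ x : Fin 2 → E4, Kj (x 0 - x 1) * F x := by
    intro j
    obtain ⟨Kj, h1, h2, h3⟩ := exists_kernel_of_translate_invariant (S₁ 2) (by positivity : 0 < dl j / 3) (hBf0 j) (hdens j) htrans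
    refine ⟨Kj, h1, h2, fun F hFc hFs => h3 F hFc ?_⟩
    have h : 3 * (dl j / 3) = dl j := by ring
    rw [h]; exact hFs
  choose KK hKKm hKKb hKKrep using hKj
  -- consistency: `KK j = KK m` a.e. on `{dl j < ‖u‖}` for `j ≤ m`
  have hcons : ∀ j m, j ≤ m → ∀ᵐ u : E4, dl j < ‖u‖ → KK j u = KK m u := by
    intro j m hjm
    have hmono : dl m ≤ dl j := by
      simp only [hdl]
      exact inv_anti₀ (by positivity) (pow_le_pow_right₀ (by norm_num) hjm)
    refine ae_eq_of_repr_eq (KK j) (KK m) (hKKm j) (hKKm m) (B := max (2 * Bf j) (2 * Bf m))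
      (fun u => (hKKb j u).trans (le_max_left _ _)) (fun u => (hKKb m u).trans (le_max_right _ _)) (dl j) ?_
    refine integral_smul_sub_eq_zero_of_repr (S₁ 2) (KK j) (KK m) (hdl_pos j) (hKKrep j) fun F hFc hFs => ?_
    exact hKKrep m F hFc (fun x hx i i' hii' => hmono.trans (hFs hx i i' hii'))
  -- the scale selector `J u = min {j | ‖u‖⁻¹ < 2^j}`
  have hex : ∀ u : E4, ∃ j : ℕ, ‖u‖⁻¹ < (2 : ℝ) ^ j := fun u => pow_unbounded_of_one_lt _ (by norm_num)
  set J : E4 → ℕ := fun u => Nat.find (hex u) with hJ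
  have hJm : Measurable J := by
    refine measurable_find hex fun k => ?_
    exact measurableSet_lt measurable_norm.inv measurable_const
  have hJspec : ∀ u, ‖u‖⁻¹ < (2 : ℝ) ^ J u := fun u => Nat.find_spec (hex u)
  have hJmin : ∀ u j, ‖u‖⁻¹ < (2 : ℝ) ^ j → J u ≤ j := fun u j hj => Nat.find_min' (hex u) hj
  have hJlt : ∀ u, u ≠ 0 → dl (J u) < ‖u‖ := by
    intro u hu
    have hpos : 0 < ‖u‖ := norm_pos_iff.2 hu
    have h := hJspec u
    simp only [hdl]
    rwa [inv_lt_comm₀ (by positivity) hpos]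
  have hpowJ : ∀ u, (2 : ℝ) ^ J u ≤ 1 + 2 * ‖u‖⁻¹ := by
    intro u
    rcases Nat.eq_zero_or_pos (J u) with h0 | hpos
    · rw [h0, pow_zero]; linarith [inv_nonneg.2 (norm_nonneg u)]
    · obtain ⟨k, hk⟩ : ∃ k, J u = k + 1 := ⟨J u - 1, by omega⟩
      have hklt : k < J u := by omega
      have hmin : ¬ (‖u‖⁻¹ < (2 : ℝ) ^ k) := Nat.find_min (hex u) hklt
      push Not at hmin
      rw [hk, pow_succ]
      linarith
  -- the glued kernel
  set K : E4 → ℂ := fun u => KK (J u) u with hK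
  have hKm : Measurable K := by
    have h : Measurable fun p : E4 × ℕ => KK p.2 p.1 := measurable_from_prod_countable_left fun n => hKKm n
    exact h.comp (measurable_id.prodMk hJm)
  refine ⟨K, hKm, ?_, ?_⟩
  · -- the polynomial bound
    refine ⟨2 * (C * (240 + 2 / ℓ₄) ^ 4) ^ 2, fun u => ?_⟩
    have hs : 0 ≤ ‖u‖⁻¹ := inv_nonneg.2 (norm_nonneg u)
    have h1 : ‖K u‖ ≤ 2 * Bf (J u) := hKKb (J u) u
    have h2 : 24 / (dl (J u) / 3) + 2 / ℓ₄ + 24 ≤ (240 + 2 / ℓ₄) * (1 + ‖u‖⁻¹) := by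
      have h3 : 24 / (dl (J u) / 3) = 72 * (2 : ℝ) ^ J u := by
        simp only [hdl]; field_simp; ring
      rw [h3]
      have h4 := hpowJ u
      have h5 : 0 < 2 / ℓ₄ := by positivity
      nlinarith [h4, hs, h5]
    have h6 : 0 ≤ 24 / (dl (J u) / 3) + 2 / ℓ₄ + 24 := by
      have := hdl_pos (J u); positivity
    calc ‖K u‖ ≤ 2 * Bf (J u) := h1
      _ = 2 * (C * (24 / (dl (J u) / 3) + 2 / ℓ₄ + 24) ^ 4) ^ 2 := by simp only [hBf]
      _ ≤ 2 * (C * ((240 + 2 / ℓ₄) * (1 + ‖u‖⁻¹)) ^ 4) ^ 2 := by gcongr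
      _ = 2 * (C * (240 + 2 / ℓ₄) ^ 4) ^ 2 * (1 + ‖u‖⁻¹) ^ 8 := by ring
  · -- the representation on every `Separated 2 δ`
    intro δ hδ F hFc hFs
    obtain ⟨m, hm⟩ : ∃ m : ℕ, dl m < δ := by
      obtain ⟨m, hm⟩ := pow_unbounded_of_one_lt δ⁻¹ (by norm_num : (1 : ℝ) < 2)
      exact ⟨m, by simp only [hdl]; rwa [inv_lt_comm₀ (by positivity) hδ]⟩
    have hFsm : tsupport (F : (Fin 2 → E4) → ℂ) ⊆ Separated 2 (dl m) := fun x hx i i' hii' =>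
      hm.le.trans (hFs hx i i' hii')
    obtain ⟨hIm, hSm⟩ := hKKrep m F hFc hFsm
    -- `K (x₀ − x₁) = KK m (x₀ − x₁)` for a.e. `x` with `F x ≠ 0`
    have hbad : ∀ᵐ u : E4, ∀ j ∈ Finset.range (m + 1), dl j < ‖u‖ → KK j u = KK m u := by
      refine (ae_ball_iff (Finset.countable_toSet _)).2 fun j hj => ?_
      exact hcons j m (by simpa [Finset.mem_range, Nat.lt_succ_iff] using hj)
    have hgood : ∀ᵐ u : E4, dl m < ‖u‖ → K u = KK m u := by
      refine hbad.mono fun u hu hum => ?_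
      have hu0 : u ≠ 0 := by
        intro h0; rw [h0, norm_zero] at hum; exact absurd hum (not_lt.2 (hdl_pos m).le)
      have hJle : J u ≤ m := hJmin u m (by
        have hpos : 0 < ‖u‖ := norm_pos_iff.2 hu0
        rw [inv_lt_comm₀ hpos (by positivity)]; simpa [hdl] using hum)
      exact hu (J u) (by simpa [Finset.mem_range, Nat.lt_succ_iff] using hJle) (hJlt u hu0)
    -- pull back to configurations
    have hgood' : ∀ᵐ x : Fin 2 → E4, dl m < ‖x 0 - x 1‖ → K (x 0 - x 1) = KK m (x 0 - x 1) := by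
      set N : Set E4 := {u | ¬(dl m < ‖u‖ → K u = KK m u)} with hN
      have hNm : MeasurableSet N := by
        have h1 : MeasurableSet {u : E4 | dl m < ‖u‖} := measurableSet_lt measurable_const measurable_norm
        have h2 : MeasurableSet {u : E4 | K u = KK m u} := measurableSet_eq_fun hKm (hKKm m)
        have hN' : N = {u : E4 | dl m < ‖u‖} ∩ {u | K u = KK m u}ᶜ := by
          ext u; simp only [hN, mem_setOf_eq, Classical.not_imp, mem_inter_iff, mem_compl_iff]
        rw [hN']; exact h1.inter h2.compl
      have hN0 : volume N = 0 := ae_iff.1 hgood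
      have hpre := (volume_preimage_sub_eq_zero_iff N hNm).2 hN0
      rw [ae_iff]
      exact hpre
    have hae : (fun x : Fin 2 → E4 => K (x 0 - x 1) * F x) =ᵐ[volume] fun x => KK m (x 0 - x 1) * F x := by
      refine hgood'.mono fun x hx => ?_
      show K (x 0 - x 1) * F x = KK m (x 0 - x 1) * F x
      by_cases hFx : F x = 0
      · simp [hFx]
      · have hlt : dl m < ‖x 0 - x 1‖ := by
          have h := hFs (subset_tsupport _ hFx) 0 1 (by decide)
          rw [dist_eq_norm] at h
          exact hm.trans_le h
        rw [hx hlt]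
    refine ⟨hIm.congr hae.symm, ?_⟩
    rw [hSm]
    exact integral_congr_ae hae.symm

end Summit.QuantumFields.YangMills.Theorems.F4SubCurvatureDoorSubCurvatureKernelGlued

end
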